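import Literature.AnabelianGeometry.EtaleTheta.SettingModelTateTheta
import Literature.AnabelianGeometry.EtaleTheta.SettingModelTateDeltaTheta
import Literature.AnabelianGeometry.EtaleTheta.SettingModelChiCyclotomes
import HarnessLib

/-!
# The stage-2 («Tate shear») root model of [EtTh] §1 (R78), row #5: the cyclotome identifications
# `μ_N ≅ (l·Δ_Θ) ⊗ ℤ/Nℤ`, a `CyclotomeTower`, and `IsCompact Δ_Θ` at `ThetaSetting.modelχq p i j`

Mochizuki, *The Étale Theta Function …* [EtTh], Publ. RIMS **45** (2009), §1 p. 12 «(`Ẑ(1) ≅`) `Δ_Θ`», §2 p. 46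
«the natural isomorphism `μ_N ≅ (l·Δ_Θ) ⊗ (ℤ/Nℤ)`», Def. 2.13 (ii) p. 48, Cor. 2.19 (ii) p. 64 (PRIMS PDF pages).  Cell
abc-iut, layer L2, seat abc-iut-L2-t8 (owner of `ThetaSetting.CyclotomeMod` / `CyclotomeTower`); R78 cluster (integrator
abc-iut-L6-d6) row #5 «t8 adapter layer», STAGE 2 twin of `SettingModelChiCyclotomes.lean` (GAP-LEDGER G-L2t10-1 /
G-w5d187-1).  PROOF-ONLY (0 definitions).

INPUTS, BY NAME: abc-iut-L2-t5's record `ThetaSetting.modelχq p i j hj` (F5q `SettingModelTateTheta.lean`: `Π^tp_X := Γ ⋊ G_{ℚ_p}`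
with the affine stage-2 action `Inn(b^m) ∘ shear ∘ θ_χ`, theta block := abc-iut-L2-d1's `CurveTheta (curveχq p i j)`,
`modelχq_isEtThOrigin`, `hYcl_modelχq`, `isOpenMap_aug_modelχq`); abc-iut-L6-d6's `Ẑ`-coordinates on the stage-2 theta
centre (F1q `SettingModelTateDeltaTheta.lean`: `deltaThetaCoordχq p i j : Ẑ →* Δ_Θ(curveχq)`, continuous, bijective, χ-law
`deltaThetaCoordχq_chi` — the shear and the inner part act TRIVIALLY on `Δ_Θ`, so `Δ_Θ(curveχq) ≅ Ẑ(χ)` exactly as at stage 1);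
this seat's engine `ThetaSetting.exists_cyclotomeMod_family_of_chiTwist_inv` / `nonempty_cyclotomeTower_of_chiTwist_inv`
(`Discharge/Sec2CyclotomeModOfChi.lean`) and `isCompact_deltaTheta_of_zHat_surjective` / `CurveTheta.t2Space_GTheta`.

RESULTS at `modelχq p i j hj` (all `i j`, `j` even, `l ≥ 1`): `t2Space_deltaTheta_modelχq`, `isCompact_deltaTheta_modelχq`,
`modelχq_exists_cyclotomeMod_family`, `modelχq_nonempty_cyclotomeMod`, `modelχq_nonempty_cyclotomeTower`, and the joint
satisfiability capstone `exists_isEtThOrigin_and_hYcl_and_isCompact_and_cyclotomeTower_tate (i j hj)` — so the §2 cyclotome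
datum is non-vacuous at EVERY stage-2 parameter, in particular at the designated Tate instance `modelχq p (-1) 2`.  HONEST
LABEL: semi-synthetic model — consistency evidence for the typed interface; nothing of [EtTh] asserted; no side taken on
[IUTchIII] Cor. 3.12; typed ≠ endorsed.
-/

noncomputable section

namespace Literature.AnabelianGeometry.EtaleTheta.SettingModel

open Literature.AnabelianGeometry.SemiGraphs

variable (p : ℕ) [Fact p.Prime]

section
variable (i j : ℤ) (hj : Even j)

/-- `Δ_Θ` of the stage-2 model is Hausdorff. [cite: MochizukiEtTh2009, §1 p.12] -/
theorem t2Space_deltaTheta_modelχq : T2Space ↥(ThetaSetting.modelχq p i j hj).DeltaTheta := by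
  haveI : T2Space (ThetaSetting.modelχq p i j hj).GtpTheta := CurveTheta.t2Space_GTheta (curveχq p i j)
  infer_instance

/-- **`Δ_Θ` of the stage-2 model is COMPACT** (image of `Ẑ` under `deltaThetaCoordχq`; GAP G-w5d187-1's binder).
[cite: MochizukiEtTh2009, §1 p.12] -/
theorem isCompact_deltaTheta_modelχq :
    IsCompact ((ThetaSetting.modelχq p i j hj).DeltaTheta : Set (ThetaSetting.modelχq p i j hj).GtpTheta) :=
  (ThetaSetting.modelχq p i j hj).isCompact_deltaTheta_of_zHat_surjective (deltaThetaCoordχq p i j)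
    (continuous_deltaThetaCoordχq p i j) (bijective_deltaThetaCoordχq p i j).2

/-- The χ-law of abc-iut-L6-d6's stage-2 coordinates in the engine's shape: `g · c^t · g⁻¹ = c^{χ(aug g)·t}` for `g ∈ Π^tp_X`
(`deltaThetaCoordχq_chi` at `toTheta g`, `aug^Θ ∘ toTheta = aug`). [cite: MochizukiEtTh2009, §1 p.12] -/
theorem conjNormal_toTheta_deltaThetaCoordχq (g : (ThetaSetting.modelχq p i j hj).PiTemp) (t : ZH) :
    MulAut.conjNormal ((ThetaSetting.modelχq p i j hj).toTheta g) (deltaThetaCoordχq p i j t) =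
      deltaThetaCoordχq p i j (chi p ((ThetaSetting.modelχq p i j hj).aug.toMonoidHom g) t) := by
  have h := deltaThetaCoordχq_chi p i j (CurveTheta.toTheta (curveχq p i j) g) t
  rw [CurveTheta.augTheta_toTheta] at h
  exact h.symm

/-- **`μ_N ≅ (l·Δ_Θ) ⊗ ℤ/Nℤ` at ALL levels, compatibly, at the stage-2 model** (`l ≥ 1`).
[cite: MochizukiEtTh2009, Def 2.13 (ii) p.48] -/
theorem modelχq_exists_cyclotomeMod_family {l : ℕ} (hl : 0 < l) :
    ∃ mods : ∀ N : ℕ+, (ThetaSetting.modelχq p i j hj).CyclotomeMod l N,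
      ∀ (M M' : ℕ+) (h : (M : ℕ) ∣ (M' : ℕ)) (x : ↥((ThetaSetting.modelχq p i j hj).lDeltaTheta l)),
        MuN.red p M M' h ((mods M').red x) = (mods M).red x := by
  haveI := t2Space_deltaTheta_modelχq p i j hj
  exact (ThetaSetting.modelχq p i j hj).exists_cyclotomeMod_family_of_chiTwist_inv hl (deltaThetaCoordχq p i j)
    (continuous_deltaThetaCoordχq p i j) (bijective_deltaThetaCoordχq p i j) (conjNormal_toTheta_deltaThetaCoordχq p i j hj)

/-- **`CyclotomeMod l N` is INHABITED at the stage-2 model** (every `l ≥ 1`, every `N`). [cite: MochizukiEtTh2009, §2 p.46] -/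
theorem modelχq_nonempty_cyclotomeMod {l : ℕ} (hl : 0 < l) (N : ℕ+) :
    Nonempty ((ThetaSetting.modelχq p i j hj).CyclotomeMod l N) := by
  obtain ⟨mods, -⟩ := modelχq_exists_cyclotomeMod_family p i j hj hl
  exact ⟨mods N⟩

/-- **A `CyclotomeTower l E` EXISTS at the stage-2 model** over every cofinal chain `E ∋ 1` (`l ≥ 1`).
[cite: MochizukiEtTh2009, Cor 2.19 (ii) p.64] -/
theorem modelχq_nonempty_cyclotomeTower {l : ℕ} (hl : 0 < l) {E : Set ℕ+} (one_mem : (1 : ℕ+) ∈ E)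
    (cofinal : ∀ n : ℕ+, ∃ M ∈ E, n ∣ M) (total : ∀ M ∈ E, ∀ M' ∈ E, M ∣ M' ∨ M' ∣ M) :
    Nonempty ((ThetaSetting.modelχq p i j hj).CyclotomeTower l E) := by
  obtain ⟨mods, hmods⟩ := modelχq_exists_cyclotomeMod_family p i j hj hl
  exact ⟨ThetaSetting.CyclotomeTower.ofAllLevels mods hmods one_mem cofinal total⟩

end

/-- **JOINT SATISFIABILITY at stage 2**: for every `(i, j)` with `j` even, the Tate-shear model is an EtTh-origin, satisfies
`hYcl`, has `Δ_Θ` compact and `aug` open, and carries `CyclotomeMod l N` at every level and a `CyclotomeTower l E` over every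
cofinal chain `E ∋ 1` (`l ≥ 1`). [cite: MochizukiEtTh2009, Cor 2.19 (ii) p.64] -/
theorem exists_isEtThOrigin_and_hYcl_and_isCompact_and_cyclotomeTower_tate (i j : ℤ) (hj : Even j) {l : ℕ}
    (hl : 0 < l) {E : Set ℕ+}
    (one_mem : (1 : ℕ+) ∈ E) (cofinal : ∀ n : ℕ+, ∃ M ∈ E, n ∣ M)
    (total : ∀ M ∈ E, ∀ M' ∈ E, M ∣ M' ∨ M' ∣ M) :
    ∃ D : ThetaSetting p, D.IsEtThOrigin ∧
      (D.DtpY.map D.toHat.toMonoidHom).topologicalClosure ≤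
        D.DtpY.map D.toHat.toMonoidHom ⊔ (⁅⁅D.DeltaHat, D.DeltaHat⁆, D.DeltaHat⁆).topologicalClosure ∧
      IsCompact (D.DeltaTheta : Set D.GtpTheta) ∧ IsOpenMap D.aug ∧
      (∀ N : ℕ+, Nonempty (D.CyclotomeMod l N)) ∧ Nonempty (D.CyclotomeTower l E) :=
  ⟨ThetaSetting.modelχq p i j hj, ThetaSetting.modelχq_isEtThOrigin p i j hj, hYcl_modelχq p i j hj,
    isCompact_deltaTheta_modelχq p i j hj, isOpenMap_aug_modelχq p i j hj, modelχq_nonempty_cyclotomeMod p i j hj hl,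
    modelχq_nonempty_cyclotomeTower p i j hj hl one_mem cofinal total⟩

end Literature.AnabelianGeometry.EtaleTheta.SettingModel

end
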